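import Literature.NumberTheory.Automorphic.PairLFunctionNeConjLevelOneOfTestVector
import Literature.NumberTheory.Automorphic.PairLFunctionNeConjLevelOneOfArchTranslate
import HarnessLib

/-!
# Mœglin–Waldspurger (i)(b) for level-one pairs over EVERY number field, from the archimedean
test-vector theorem

Topic `NumberTheory/Automorphic`; namespace `Literature.NumberTheory.Automorphic`. One theorem.
`exists_entire_eq_partialPairL_of_levelOne_of_testVector` (`PairLFunctionNeConjLevelOneOfTestVector`)
derives the conclusion of the named fact `MoeglinWaldspurger1989_partialPairL_entire_of_ne_conj` for
level-one pairs from the archimedean named fact `HumphriesJo2024_archRankinSelberg_testVector` over a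
number field with trivial different. Combining its bridge `archPairLFactorData_of_testVector` with the
translated level-one theorem `exists_entire_eq_partialPairL_of_levelOne_of_archPairLFactorData'`
(`PairLFunctionNeConjLevelOneOfArchTranslate`, any different, via the torus of Whittaker shifts) gives
the same conclusion over EVERY number field (`exists_entire_eq_partialPairL_of_levelOne_of_testVector'`).

## References

* C. Mœglin, J.-L. Waldspurger, *Le spectre résiduel de GL(n)*, Ann. Sci. ÉNS 22 (1989), Appendice,
  Corollaire (i)(b), p. 667 [MoeglinWaldspurger1989].
* J. W. Cogdell, *Analytic theory of L-functions for GL_n* (2004), §3.1–§3.2, §4.1–§4.2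
  [CogdellAnalyticTheory2004].
* P. Humphries, Y. Jo, *Test vectors for archimedean period integrals*, Publ. Mat. 68 (2024),
  Thm. 1.1, Thm. 5.6 [HumphriesJo2024].
-/

noncomputable section

open MeasureTheory Measure NumberField NumberField.mixedEmbedding IsDedekindDomain Set Filter
open Literature.NumberTheory.GaloisRepresentations (ideleGroup)
open scoped MatrixGroups ENNReal NNReal Classical ComplexConjugate

namespace Literature.NumberTheory.Automorphic

section Final

open ValuativeRel

-- the automorphic quotient carries the tree's Borel σ-algebra, not Mathlib's quotient σ-algebra
attribute [-instance] Quotient.instMeasurableSpace QuotientGroup.measurableSpace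

variable {n : ℕ} {K : Type} [Field K] [NumberField K]
variable {μ' : Measure (AdelicGroupData.gl n K).automorphicQuotient} [(AdelicGroupData.gl n K).IsAutomorphicMeasure μ']

attribute [local instance] adelicBorel borelSpace_adelic locallyCompactSpace_adelic secondCountableTopology_gl_adelic
  glAdeleBorel borelSpace_glAdele borelSpace_ideleGroup secondCountableTopology_ideleGroup

attribute [local instance] Literature.MeasureTheory.Group.hasSummableGeomSeries_of_finiteDimensional
  Literature.MeasureTheory.Group.Units.borelSpace_of_isOpenEmbedding
  Literature.MeasureTheory.Group.Units.secondCountableTopology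
  Literature.MeasureTheory.Group.Units.locallyCompactSpace

attribute [local instance] borelSpace_pi_mixedUnits measurableMul_pi_mixedUnits

variable [MeasurableSpace (AdeleRing (𝓞 K) K)] [BorelSpace (AdeleRing (𝓞 K) K)]
variable [MeasurableSpace (GL (Fin n) (mixedSpace K))] [BorelSpace (GL (Fin n) (mixedSpace K))]

/-- **Mœglin–Waldspurger, Appendice, Corollaire (i)(b), for level-one pairs over EVERY number field,
from the archimedean test-vector theorem.** For `n ≥ 1`, multiplicity one for `GL_n / K`, ANY number
field `K`, and cuspidal automorphic representations `π`, `π'` of `GL_n(𝔸_K)` with Satake parameters at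
EVERY finite place for the level `GL_n(𝒪_v)` (level one) and `π ≠ π̄'`, the partial Rankin–Selberg
`L`-function `partialPairL T α β` (`re s > 1`) extends to an entire function for every finite `T` —
granted the archimedean named fact `HumphriesJo2024_archRankinSelberg_testVector n K`. This removes
the hypothesis `𝔡_K = 1` of `exists_entire_eq_partialPairL_of_levelOne_of_testVector` (translation by
the torus of Whittaker shifts at the places above the different, Cogdell (2004), §3.1).
[cite: MoeglinWaldspurger1989, Appendice, Corollaire (i)(b), p. 667]
[cite: CogdellAnalyticTheory2004, §3.1–§3.2 and §4.1–§4.2] [cite: HumphriesJo2024, Thm. 1.1 and Thm. 5.6] -/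
theorem exists_entire_eq_partialPairL_of_levelOne_of_testVector'
    (h : HumphriesJo2024_archRankinSelberg_testVector n K)
    (νI : Measure (ideleGroup K)) [νI.IsHaarMeasure]
    (νA : Measure (Fin n → ideleGroup K)) [IsHaarMeasure νA]
    (νK : Measure ↥(maximalCompactAdelic n K)) [IsHaarMeasure νK]
    (ν₀ : Measure ↥(adelicUnipotent n K)) [IsHaarMeasure ν₀]
    (hn : 0 < n) (h₁ : multiplicity_one_gl n K μ')
    (P P' : CuspidalAutomorphicRepGL n K μ') (hne : P ≠ P'.conj)
    {α₀ β₀ : SatakeFamily K}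
    (hP : ∀ v : HeightOneSpectrum (𝓞 K), ∃ ϖ : (v.adicCompletion K)ˣ,
      HasSatakeParameterAt P.1 (glIntegralLevel n K) v ϖ (α₀ v))
    (hP' : ∀ v : HeightOneSpectrum (𝓞 K), ∃ ϖ : (v.adicCompletion K)ˣ,
      HasSatakeParameterAt P'.1 (glIntegralLevel n K) v ϖ (β₀ v))
    {T : Set (HeightOneSpectrum (𝓞 K))} (hT : T.Finite) {α β : SatakeFamily K}
    (hα : IsSatakeFamilyOf P T α) (hβ : IsSatakeFamilyOf P' T β) :
    ∃ g : ℂ → ℂ, Differentiable ℂ g ∧ ∀ s : ℂ, 1 < s.re → g s = partialPairL T α β s :=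
  exists_entire_eq_partialPairL_of_levelOne_of_archPairLFactorData' (archPairLFactorData_of_testVector h)
    νI νA νK ν₀ hn h₁ P P' hne hP hP' hT hα hβ

end Final

end Literature.NumberTheory.Automorphic
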